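import Literature.AnabelianGeometry.SemiGraphs.WitnessIwahoriCoherent
import Literature.AnabelianGeometry.SemiGraphs.CoveringGraphLocallyFinite
import HarnessLib

/-!
# The universal graph-covering over a loop is INFINITE: `𝒢₁,∞` is a kernel-certified infinite, locally
# finite carrier of the [SemiAnbd] Thm 3.7 (iii)/(iv) At-forms (NV certificate)

Mochizuki, *Semi-graphs of anabelioids*, Publ. RIMS **42** (2006), §1 p. 15 ("universal graph-coverings";
p. 16: the graph `H_1` with one vertex and one edge, `π₁(H_1) = ℤ`), §3 p. 38 ("`𝒢_{∞,i} → 𝒢_i` for the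
covering of `𝒢_i` determined by the universal graph-covering of the underlying semi-graph `𝔾_i`"),
Thm. 3.7 (iii)/(iv) pp. 40–41 [cite: MochizukiSemiAnbd2006, Prop 3.6 p.38].

PROOF-ONLY (cell abc-iut, layer L3, row «UNIVERSAL-COVERING-INFINITE», L3-lead γ64 (2); seat
abc-iut-w6-d120 gen 5; no definition, no new named fact).  The cell's ∀-countable typings of Thm 3.7 (iii)
`CompactInVerticial` (F-1732) and (iv) `MaximalCompactIffVerticial` (F-1750) are REFUTED AS TYPED at infinite
carriers of infinite valence (the θ-ray `𝒢_θ`, the rayless star); the per-graph At-forms HOLD hypothesis-free at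
every finite graph and at the universal graph-coverings `𝒢_{∞,F}` of finite coherent Thm-3.7 graphs
(`UniversalCoveringCompactInVerticial.lean`, p456054; at the Iwahori loop `𝒢₁`: `WitnessIwahoriCoherent.lean`,
p463098).  That `𝒢_{∞,F}` is an INFINITE graph as soon as `𝔾` has a cycle was so far asserted in prose only.
This file certifies it in the kernel:

* `SemiGraph.infinite_fundamentalGroup_of_loop` — a semi-graph with an edge whose two branches abut to one
  vertex `v` has INFINITE `π₁(𝔾, v)` (label functor to `ℤ` through `Quiver.FreeGroupoid.lift`: the loop
  class maps to `1`, so its powers are pairwise distinct);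
* `CovObj.infinite_orbits_univCoverOver_of_infinite_hom` / `…infinite_vertex_univCoverOver_of_infinite_hom`
  — if the hom-set `c ⟶ V` of the fundamental groupoid of `𝔾_S` is infinite, then `𝒢_{∞,S}` (based at `c`)
  has infinitely many vertex-orbits over the base vertex of `V` (the `Π_v`-action on the fibre `(V, x, p)`
  moves only the point `x`, so distinct path classes `p` give distinct orbits);
* `CovObj.infinite_vertex_univCoverOver_of_loop` — hence `𝒢_{∞,S}` is infinite whenever `𝔾_S` has a loop
  at the base vertex-orbit;
* ★ `IwahoriWitness.infinite_vertex_univCover_loopGraph` — the universal graph-covering `𝒢₁,∞` of the Iwahori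
  loop `𝒢₁ = loopGraph p` (the carrier of p463098) is an INFINITE graph, and
  `IwahoriWitness.isLocallyFinite_univCover_loopGraph` — it is locally finite;
* ★ `IwahoriWitness.exists_infinite_locallyFinite_thm37_graph_compactInVerticialAt` — packaged NV sentence:
  there is a countable, INFINITE, locally finite Thm-3.7 graph (strictly coherent) at which
  `CompactInVerticialAt` AND `MaximalCompactIffVerticialAt` hold with NO hypothesis — so the dividing line
  for the At-forms of F-1732/F-1750 is «infinite valence», not «infinite».

Honest framing: statements about OUR typed objects; instance ≠ ∀-closure (both ∀-closures stay refuted);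
nothing here takes a side on [IUTchIII] Cor. 3.12; typed ≠ proved elsewhere.
-/

noncomputable section

namespace Literature.AnabelianGeometry.SemiGraphs

open CategoryTheory Quiver

universe u

/-! ### A loop makes the fundamental group infinite -/

namespace SemiGraph

/-- **A semi-graph with a loop has infinite fundamental group at the loop's vertex** ([SemiAnbd] §1 p. 16:
`π₁` of the one-vertex one-edge graph `H_1` is `ℤ`): if the two distinct branches `b₀ ≠ b₁` of an edge `e`
both abut to `v`, the classes `(b₀⁻¹ · b₁)ⁿ ∈ π₁(𝔾, v)` are pairwise distinct — they are separated by the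
label functor `Π(𝔾) ⥤ ℤ` (universal property of the free groupoid) sending the arrow `b₁ : e → v` to `1`
and every other arrow of `Cat(𝔾)` to `0`. [cite: MochizukiSemiAnbd2006, §1 p.16] -/
theorem infinite_fundamentalGroup_of_loop (G : SemiGraph.{u}) {e : G.Edge} {v : G.Vertex}
    {b₀ b₁ : G.Branch} (hne : b₀ ≠ b₁) (h₀ : G.edgeOf b₀ = e) (a₀ : G.abuts b₀ = some v)
    (h₁ : G.edgeOf b₁ = e) (a₁ : G.abuts b₁ = some v) :
    Infinite (G.FundamentalGroup (Sum.inl v)) := by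
  classical
  -- the two arrows `e → v` of `Cat(𝔾)` given by the branches
  let β₀ : @Quiver.Hom G.CatCarrier _ (Sum.inr e) (Sum.inl v) := ⟨b₀, h₀, a₀⟩
  let β₁ : @Quiver.Hom G.CatCarrier _ (Sum.inr e) (Sum.inl v) := ⟨b₁, h₁, a₁⟩
  -- the label prefunctor: `b₁ ↦ 1 ∈ ℤ`, every other arrow `↦ 0` (written multiplicatively)
  let φ : G.CatCarrier ⥤q CategoryTheory.SingleObj (Multiplicative ℤ) :=
    { obj := fun _ => CategoryTheory.SingleObj.star _
      map := fun {X Y} f => match X, Y, f with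
        | Sum.inr _, Sum.inl _, f => if f.1 = b₁ then Multiplicative.ofAdd (1 : ℤ) else 1
        | Sum.inl _, Sum.inl _, f => PEmpty.elim f
        | Sum.inl _, Sum.inr _, f => PEmpty.elim f
        | Sum.inr _, Sum.inr _, f => PEmpty.elim f }
  let L : G.FundamentalGroupoid ⥤ CategoryTheory.SingleObj (Multiplicative ℤ) := Quiver.FreeGroupoid.lift φ
  let x₀ : G.basept (Sum.inr e) ⟶ G.basept (Sum.inl v) := (Quiver.FreeGroupoid.of G.CatCarrier).map β₀
  let x₁ : G.basept (Sum.inr e) ⟶ G.basept (Sum.inl v) := (Quiver.FreeGroupoid.of G.CatCarrier).map β₁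
  -- the same arrows in the symmetrised quiver (forward direction)
  let f₀ : @Quiver.Hom (Symmetrify G.CatCarrier) _ (Sum.inr e) (Sum.inl v) := Sum.inl β₀
  let f₁ : @Quiver.Hom (Symmetrify G.CatCarrier) _ (Sum.inr e) (Sum.inl v) := Sum.inl β₁
  have hx₀ : (L.map x₀ : Multiplicative ℤ) = (1 : Multiplicative ℤ) := by
    change (Paths.lift (Symmetrify.lift φ)).map f₀.toPath = _
    rw [Paths.lift_toPath]
    change (if b₀ = b₁ then Multiplicative.ofAdd (1 : ℤ) else 1) = (1 : Multiplicative ℤ)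
    rw [if_neg hne]
  have hx₁ : (L.map x₁ : Multiplicative ℤ) = Multiplicative.ofAdd (1 : ℤ) := by
    change (Paths.lift (Symmetrify.lift φ)).map f₁.toPath = _
    rw [Paths.lift_toPath]
    change (if b₁ = b₁ then Multiplicative.ofAdd (1 : ℤ) else 1) = _
    rw [if_pos rfl]
  -- the loop `v ⟵ e ⟶ v`: in through `b₀` (backwards), out through `b₁`
  let ℓ : G.FundamentalGroup (Sum.inl v) := Groupoid.inv x₀ ≫ x₁
  have hℓ : (L.map ℓ : Multiplicative ℤ) = Multiplicative.ofAdd (1 : ℤ) := by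
    change (L.map (Groupoid.inv x₀ ≫ x₁) : Multiplicative ℤ) = _
    rw [Functor.map_comp, Groupoid.inv_eq_inv, Functor.map_inv, SingleObj.inv_as_inv, SingleObj.comp_as_mul,
      hx₀, hx₁]
    show Multiplicative.ofAdd (1 : ℤ) * (1 : Multiplicative ℤ)⁻¹ = Multiplicative.ofAdd (1 : ℤ)
    rw [inv_one, mul_one]
  have hpow : ∀ n : ℕ, (L.map (ℓ ^ n) : Multiplicative ℤ) = Multiplicative.ofAdd (n : ℤ) := by
    intro n
    induction n with
    | zero =>
      rw [pow_zero, Nat.cast_zero, ofAdd_zero]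
      exact L.map_id _
    | succ n ih =>
      rw [pow_succ, Groupoid.vertexGroup_mul, Functor.map_comp, SingleObj.comp_as_mul, ih, hℓ, Nat.cast_succ,
        ofAdd_add, mul_comm]
  refine Infinite.of_injective (fun n : ℕ => ℓ ^ n) fun m n hmn => ?_
  have hm := hpow m
  rw [show ℓ ^ m = ℓ ^ n from hmn, hpow n] at hm
  exact_mod_cast (Multiplicative.ofAdd.injective hm).symm

end SemiGraph

/-! ### Infinitely many path classes give infinitely many vertices of `𝒢_{∞,S}` -/

namespace ProfiniteSemiGraph

namespace CovObj

variable {𝒢 : ProfiniteSemiGraph.{u}} (S : CovObj 𝒢) (c : S.orbitGraph.CatCarrier) (h𝒢 : 𝒢.IsCountable)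

/-- **Distinct path classes give distinct vertex-orbits of `𝒢_{∞,S}`** ([SemiAnbd] §3 p. 38: the fibre of
`𝒢_{∞,S}` over `v` is the set of triples `(V, x, p)`, `p : c ⟶ V` a vertex of the universal graph-covering
`𝔾̃_S` over `V`, with `Π_v` acting through `x` only): if the hom-set `c ⟶ V` of the fundamental groupoid of
`𝔾_S` is infinite for a vertex-orbit `V` over `v`, then `Π_v` has infinitely many orbits on the fibre of
`𝒢_{∞,S}` over `v`. [cite: MochizukiSemiAnbd2006, Prop 3.6 p.38] -/
theorem infinite_orbits_univCoverOver_of_infinite_hom {v : 𝒢.graph.Vertex} (V : S.OVertex)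
    (hV : OVertex.base S V = v) (hinf : Infinite (S.orbitGraph.basept c ⟶ S.orbitGraph.basept (Sum.inl V))) :
    Infinite (BTemp.Orbits ((S.univCoverOver c h𝒢).SV v)) := by
  -- a point of the orbit `V`
  obtain ⟨⟨v', x⟩, hx⟩ := Quot.exists_rep V
  have hv' : v' = v := by rw [← hV, ← hx]; rfl
  subst hv'
  refine Infinite.of_injective
    (fun p : S.orbitGraph.basept c ⟶ S.orbitGraph.basept (Sum.inl V) =>
      BTemp.cl ((S.univCoverOver c h𝒢).SV v') (⟨⟨V, hV⟩, ⟨⟨x, hx⟩, p⟩⟩ : S.FibV c v')) fun p q hpq => ?_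
  obtain ⟨g, hg⟩ := (BTemp.cl_eq_cl_iff _ _ _).mp hpq
  -- the action is `fibVAct`, which fixes the orbit and the path coordinate
  have hg' : S.fibVAct c v' g ⟨⟨V, hV⟩, ⟨⟨x, hx⟩, p⟩⟩ = ⟨⟨V, hV⟩, ⟨⟨x, hx⟩, q⟩⟩ := hg
  exact congrArg Prod.snd (eq_of_heq (Sigma.mk.inj_iff.mp hg').2)

/-- **… hence infinitely many vertices of the covering semi-graph of `𝒢_{∞,S}`** (the vertices of `𝒢_S′`
for `S′ = 𝒢_{∞,S}` are the pairs (vertex of `𝔾`, `Π_v`-orbit), Def. 3.5 (i)).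
[cite: MochizukiSemiAnbd2006, Def 3.5(i) p.37] -/
theorem infinite_vertex_univCoverOver_of_infinite_hom {v : 𝒢.graph.Vertex} (V : S.OVertex)
    (hV : OVertex.base S V = v) (hinf : Infinite (S.orbitGraph.basept c ⟶ S.orbitGraph.basept (Sum.inl V))) :
    Infinite (S.univCoverOver c h𝒢).coveringGraph.graph.Vertex := by
  haveI := S.infinite_orbits_univCoverOver_of_infinite_hom c h𝒢 V hV hinf
  exact Infinite.of_injective
    (fun ω : BTemp.Orbits ((S.univCoverOver c h𝒢).SV v) =>
      (⟨v, ω⟩ : (S.univCoverOver c h𝒢).coveringGraph.graph.Vertex))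
    fun ω ω' h => eq_of_heq (Sigma.mk.inj_iff.mp h).2

/-- **`𝒢_{∞,S}` is infinite as soon as `𝔾_S` has a loop at the base vertex-orbit** (based at `c = V`):
two distinct branches of one edge-orbit of `𝔾_S` abutting to `V` make `π₁(𝔾_S, V)` infinite
(`SemiGraph.infinite_fundamentalGroup_of_loop`), whence infinitely many vertices of `𝒢_{∞,S}` over the base
vertex of `V`. [cite: MochizukiSemiAnbd2006, Prop 3.6 p.38] -/
theorem infinite_vertex_univCoverOver_of_loop (V : S.OVertex) {E : S.orbitGraph.Edge}
    {β₀ β₁ : S.orbitGraph.Branch} (hne : β₀ ≠ β₁) (h₀ : S.orbitGraph.edgeOf β₀ = E)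
    (a₀ : S.orbitGraph.abuts β₀ = some V) (h₁ : S.orbitGraph.edgeOf β₁ = E)
    (a₁ : S.orbitGraph.abuts β₁ = some V) :
    Infinite (S.univCoverOver (Sum.inl V) h𝒢).coveringGraph.graph.Vertex :=
  S.infinite_vertex_univCoverOver_of_infinite_hom (Sum.inl V) h𝒢 V rfl
    (S.orbitGraph.infinite_fundamentalGroup_of_loop hne h₀ a₀ h₁ a₁)

/-- For the ONE-SHEETED trivial covering `S = trivialCov 𝒢 PUnit` (`𝔾_S = 𝔾`), vertex-orbits are determined
by their base vertex (each fibre is a single point). [cite: MochizukiSemiAnbd2006, Def 3.5(i) p.37] -/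
theorem oVertex_trivialCov_punit_eq_of_base_eq {V W : (CovObj.trivialCov 𝒢 PUnit.{u + 1}).OVertex}
    (h : OVertex.base _ V = OVertex.base _ W) : V = W := by
  induction V using Quot.ind with
  | mk a =>
    induction W using Quot.ind with
    | mk b =>
      obtain ⟨v, x⟩ := a
      obtain ⟨w, y⟩ := b
      change v = w at h
      subst h
      rfl

end CovObj

end ProfiniteSemiGraph

/-! ### The universal graph-covering `𝒢₁,∞` of the Iwahori loop is an infinite, locally finite graph -/

namespace IwahoriWitness

open ProfiniteSemiGraph

variable (p : ℕ) [Fact p.Prime]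

/-- All vertex-orbits of the one-sheeted covering of `𝒢₁` coincide (one vertex, one-point fibre).
[cite: MochizukiSemiAnbd2006, Def 3.5(i) p.37] -/
theorem oVertex_trivialCov_loopGraph_eq (V W : (CovObj.trivialCov (loopGraph p) PUnit.{1}).OVertex) : V = W :=
  CovObj.oVertex_trivialCov_punit_eq_of_base_eq rfl

/-- ★ **`𝒢₁,∞` is an INFINITE graph**: the universal graph-covering of the Iwahori loop `𝒢₁ = loopGraph p`
(based at any vertex-orbit `V₀` of its one-sheeted covering — there is exactly one) has infinitely many
vertices: `𝔾_{𝒢₁} = H_1` has a loop, `π₁(H_1, ⋆)` is infinite, and the vertices of `𝒢₁,∞` over `⋆` are a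
`π₁`-torsor ([SemiAnbd] §1 p. 16, §3 p. 38).  This is the carrier of p463098's hypothesis-free instances
`compactInVerticialAt_univCover_loopGraph` / `maximalCompactIffVerticialAt_univCover_loopGraph`.
[cite: MochizukiSemiAnbd2006, Prop 3.6 p.38] -/
theorem infinite_vertex_univCover_loopGraph (V₀ : (CovObj.trivialCov (loopGraph p) PUnit.{1}).OVertex) :
    Infinite ((CovObj.trivialCov (loopGraph p) PUnit.{1}).univCoverOver (Sum.inl V₀)
        (loopGraph_thm37Hypotheses p).isCountable).coveringGraph.graph.Vertex := by
  let S := CovObj.trivialCov (loopGraph p) PUnit.{1}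
  -- the two branches of the loop of `H_1`, and the edge-orbit over it
  let b₀ : (loopGraph p).graph.Branch := ULift.up ((0 : Fin 1), false)
  let b₁ : (loopGraph p).graph.Branch := ULift.up ((0 : Fin 1), true)
  have hb : b₀ ≠ b₁ := fun h => Bool.false_ne_true (congrArg (fun b : (loopGraph p).graph.Branch => b.down.2) h)
  let E₀ : S.OEdge := Quot.mk _ ⟨(loopGraph p).graph.edgeOf b₀, PUnit.unit⟩
  have hE₀ : CovObj.OEdge.base S E₀ = (loopGraph p).graph.edgeOf b₀ := rfl
  have hE₁ : CovObj.OEdge.base S E₀ = (loopGraph p).graph.edgeOf b₁ := rfl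
  -- every branch of `𝔾_S` over the loop abuts to `V₀`
  have ha : ∀ (b : (loopGraph p).graph.Branch) (hE : CovObj.OEdge.base S E₀ = (loopGraph p).graph.edgeOf b),
      S.orbitGraph.abuts ⟨(b, E₀), hE⟩ = some V₀ := by
    intro b hE
    rw [S.orbitGraph_abuts_of_abuts b E₀ hE PUnit.unit rfl]
    obtain ⟨W, hW⟩ := Option.isSome_iff_exists.mp (S.glueOpt_isSome b PUnit.unit rfl E₀ hE)
    rw [hW, oVertex_trivialCov_loopGraph_eq p W V₀]
  exact S.infinite_vertex_univCoverOver_of_loop (loopGraph_thm37Hypotheses p).isCountable V₀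
    (β₀ := ⟨(b₀, E₀), hE₀⟩) (β₁ := ⟨(b₁, E₀), hE₁⟩)
    (fun h => hb (congrArg (fun β : S.orbitGraph.Branch => β.1.1) h)) rfl (ha b₀ hE₀) rfl (ha b₁ hE₁)

/-- **`𝒢₁,∞` is locally finite** (a covering semi-graph over the finite graph `H_1`; abc-iut-L3-d1's
`CovObj.isLocallyFinite_univCoverOver`, BY NAME). [cite: MochizukiSemiAnbd2006, Prop 3.6 p.38] -/
theorem isLocallyFinite_univCover_loopGraph (V₀ : (CovObj.trivialCov (loopGraph p) PUnit.{1}).OVertex) :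
    ((CovObj.trivialCov (loopGraph p) PUnit.{1}).univCoverOver (Sum.inl V₀)
        (loopGraph_thm37Hypotheses p).isCountable).coveringGraph.graph.IsLocallyFinite :=
  haveI : Finite (loopGraph p).graph.Edge := (loopGraph_isFinite p).finite_edge
  (CovObj.trivialCov (loopGraph p) PUnit.{1}).isLocallyFinite_univCoverOver isLocallyFinite_of_finite_edge _ _

/-- ★ **NV certificate for the At-forms of [SemiAnbd] Thm 3.7 (iii)/(iv) at an INFINITE carrier**: there is a
countable, INFINITE, locally finite semi-graph of anabelioids satisfying the hypotheses of Thm 3.7 (indeed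
strictly coherent) at which `CompactInVerticialAt` AND `MaximalCompactIffVerticialAt` hold with NO hypothesis
— namely `𝒢₁,∞` for `p = 2` (instances p463098; infinitude and local finiteness above).  So the kernel
refutations of the ∀-countable typings F-1732/F-1750 (θ-ray, rayless star: infinite VALENCE) and the positive
instances are separated by «infinite valence», not by «infinite». [cite: MochizukiSemiAnbd2006, Thm 3.7(iii)(iv) pp.40-41] -/
theorem exists_infinite_locallyFinite_thm37_graph_compactInVerticialAt :
    ∃ 𝒢 : ProfiniteSemiGraph.{0}, 𝒢.Thm37Hypotheses ∧ 𝒢.IsStrictlyCoherent ∧ 𝒢.IsCountable ∧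
      Infinite 𝒢.graph.Vertex ∧ 𝒢.graph.IsLocallyFinite ∧
      CompactInVerticialAt 𝒢 ∧ MaximalCompactIffVerticialAt 𝒢 := by
  haveI : Fact (Nat.Prime 2) := ⟨Nat.prime_two⟩
  let V₀ : (CovObj.trivialCov (loopGraph 2) PUnit.{1}).OVertex := Quot.mk _ ⟨PUnit.unit, PUnit.unit⟩
  obtain ⟨h37, hsc⟩ := thm37Hypotheses_univCover_loopGraph 2 V₀
  exact ⟨_, h37, hsc, h37.isCountable, infinite_vertex_univCover_loopGraph 2 V₀,
    isLocallyFinite_univCover_loopGraph 2 V₀, compactInVerticialAt_univCover_loopGraph 2 V₀,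
    maximalCompactIffVerticialAt_univCover_loopGraph 2 V₀⟩

end IwahoriWitness

end Literature.AnabelianGeometry.SemiGraphs

end
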